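import Summits.Ventures.CertifiedArithmetic.LowPrec.TwoSum
import Summits.Ventures.CertifiedArithmetic.LowPrec.Successor
import Summits.Ventures.CertifiedArithmetic.LowPrec.SRSpacing
import Summits.Ventures.CertifiedArithmetic.LowPrec.SRBiasSign
import HarnessLib

/-!
# Stochastic rounding into a finite format, XXVII: faithful roundings; Fast2Sum's exact steps

HONEST FRAMING: certified error envelopes and provably optimal rounding/accumulation schemes for
low-precision formats under stated cost models; every table by two implementations; no hardware or
vendor claims.

Venture CertifiedArithmetic / lowprec, SR slice (gen7): error-free transformations EXECUTED under
stochastic rounding. A realisation of one saturating SR step (file I: candidates `dn F c`, `up F c`)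
is a FAITHFUL saturating rounding of `c` into the finite number system `F`:

* `Faithful F c s` — `s ∈ F` and `s` is either the largest element of `F` that is `≤ c` or the
  smallest that is `≥ c` (for `c` beyond `max F` only `max F` qualifies: saturation; for `c ∈ F`
  only `c`); `dn_faithful`, `up_faithful`; `step_congr_faithful` / `step_eq_of_faithful` — an SR
  expectation `E f(SR c)` only sees `f` on faithful roundings of `c`.

For the value set `F = valueSet φ` of ANY minifloat format `φ` of the venture (subnormals, both
signs, saturation at `±maxRat`; no infinities) and data `a, b` with `|b| ≤ |a|`:

* `sub_mem_of_faithful` — **for every faithful rounding `s` of `a + b`, `s − a ∈ F`** (so the second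
  operation of Dekker's Fast2Sum, `z = ∘(s − a)`, is exact under ANY faithful rounding `∘`, in
  particular under every realisation of SR). This is [BoldoGraillatMuller2017, Lemma 2.5]
  (radix 2, `s ∈ {RD, RU}(a + b)`, unbounded exponents) transported to the finite saturating model:
  the proof is by Sterbenz (`Sterbenz.lean`) on `(s, a)` with `a/2 ≤ s ≤ 2a`, the two escape cases
  — near-cancellation `|a + b| < |b|` and a bottom-binade `a` with `a/2 ∉ F` — being exactly those
  where `a + b ∈ F`, so that `s = a + b` and `s − a = b`; saturation only removes candidates.
* `abs_err_le_maxRat_of_faithful` / `inHull_err_of_faithful` — the committed error `a + b − s` of a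
  faithful rounding lies in the representable hull `[−maxRat, maxRat]` (it need NOT be `≤ |b|`:
  E3M2, `a = 24`, `b = 1/16`, `s = RU = 28`, error `−63/16`), hence one further saturating SR step
  rounds it WITHOUT saturation bias (file I `step_id_eq_self_iff`).

File XXVIII (`SRFast2Sum`) assembles these into the law of Fast2Sum under SR. Placement: no analysis
of Fast2Sum/2Sum executed under stochastic rounding was found ([BoldoGraillatMuller2017] treats
faithful/directed roundings with overflow to `±∞`; the SR surveys [CrociEtAl2022] §7 and
arXiv:2603.06060 mention EFTs only as an implementation device for SR); searches in
`pub-lowprec-sr/FRESHNESS-SR.md` (gen7).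
-/

namespace Summit.Ventures.CertifiedArithmetic.LowPrec.SR

open Literature.ComputerArithmetic.ConnollyHighamMary2021 Finset

section Generic

variable {K : Type*} [Field K] [LinearOrder K] [IsStrictOrderedRing K]

/-! ### Faithful saturating roundings into a finite number system -/

/-- `s` is a FAITHFUL (saturating) rounding of `c` into `F`: `s ∈ F`, and either `s ≤ c` with no
element of `F` in `(s, c]`, or `c ≤ s` with no element of `F` in `[c, s)`.
[cite: BoldoGraillatMuller2017, §2 (faithful rounding `∘(x) ∈ {RD(x), RU(x)}`); saturating form
new] -/
def Faithful (F : Finset K) (c s : K) : Prop :=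
  s ∈ F ∧ ((s ≤ c ∧ ∀ y ∈ F, y ≤ c → y ≤ s) ∨ (c ≤ s ∧ ∀ y ∈ F, c ≤ y → s ≤ y))

omit [Field K] [IsStrictOrderedRing K] in
/-- A faithful rounding is an element of `F`. -/
theorem Faithful.mem {F : Finset K} {c s : K} (h : Faithful F c s) : s ∈ F := h.1

omit [Field K] [IsStrictOrderedRing K] in
/-- The only faithful rounding of an element of `F` is itself. -/
theorem Faithful.eq_of_mem {F : Finset K} {c s : K} (hs : Faithful F c s) (hc : c ∈ F) : s = c := by
  rcases hs.2 with ⟨hsc, hmax⟩ | ⟨hcs, hmin⟩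
  · exact le_antisymm hsc (hmax c hc le_rfl)
  · exact le_antisymm (hmin c hc le_rfl) hcs

omit [Field K] [IsStrictOrderedRing K] in
/-- The lower candidate `dn F c` of a saturating SR step is a faithful rounding of `c`. -/
theorem dn_faithful {F : Finset K} (hF : F.Nonempty) (c : K) : Faithful F c (dn F c) := by
  refine ⟨dn_mem hF c, ?_⟩
  by_cases h : ∃ x ∈ F, x ≤ c
  · obtain ⟨x, hx, hxc⟩ := h
    exact Or.inl ⟨(roundDown_le F _).trans (clamp_le_self_of_mem hx hxc),
      fun y hy hyc => le_dn_of_mem hy hyc⟩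
  · push Not at h
    exact Or.inr ⟨(h _ (dn_mem hF c)).le,
      fun y hy hcy => (roundDown_le_roundUp F _).trans (up_le_of_mem hy hcy)⟩

omit [Field K] [IsStrictOrderedRing K] in
/-- The upper candidate `up F c` of a saturating SR step is a faithful rounding of `c`. -/
theorem up_faithful {F : Finset K} (hF : F.Nonempty) (c : K) : Faithful F c (up F c) := by
  refine ⟨up_mem hF c, ?_⟩
  by_cases h : ∃ x ∈ F, c ≤ x
  · obtain ⟨x, hx, hcx⟩ := h
    exact Or.inr ⟨(self_le_clamp_of_mem hx hcx).trans (le_roundUp F _),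
      fun y hy hcy => up_le_of_mem hy hcy⟩
  · push Not at h
    exact Or.inl ⟨(h _ (up_mem hF c)).le,
      fun y hy hyc => (le_dn_of_mem hy hyc).trans (roundDown_le_roundUp F _)⟩

/-- Faithfulness is symmetric under negation when `F` is. -/
theorem Faithful.neg {F : Finset K} (hF : ∀ y ∈ F, -y ∈ F) {c s : K} (hs : Faithful F c s) :
    Faithful F (-c) (-s) := by
  refine ⟨hF s hs.1, ?_⟩
  rcases hs.2 with ⟨hsc, hmax⟩ | ⟨hcs, hmin⟩
  · refine Or.inr ⟨neg_le_neg hsc, fun y hy hcy => ?_⟩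
    have := hmax (-y) (hF y hy) (by linarith)
    linarith
  · refine Or.inl ⟨neg_le_neg hcs, fun y hy hyc => ?_⟩
    have := hmin (-y) (hF y hy) (by linarith)
    linarith

omit [IsStrictOrderedRing K] in
/-- An SR expectation `E f(SR c)` is determined by `f` on the faithful roundings of `c`. -/
theorem step_congr_faithful {F : Finset K} (hF : F.Nonempty) (c : K) {f g : K → K}
    (h : ∀ s, Faithful F c s → f s = g s) : step F c f = step F c g :=
  step_congr F c (h _ (up_faithful hF c)) (h _ (dn_faithful hF c))

omit [IsStrictOrderedRing K] in
/-- If `f` is constant `= v` on the faithful roundings of `c` then `E f(SR c) = v`. -/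
theorem step_eq_of_faithful {F : Finset K} (hF : F.Nonempty) (c : K) {f : K → K} {v : K}
    (h : ∀ s, Faithful F c s → f s = v) : step F c f = v := by
  rw [step_congr_faithful hF c (g := fun _ => v) h, step_const]

end Generic

/-! ### The value set of a minifloat format -/

section Formats

open Literature.ComputerArithmetic.FloatingPoint
open Literature.ComputerArithmetic.FloatingPoint.MiniFloat

variable {φ : Format}

/-- The value set is closed under negation (sign flip). -/
theorem neg_mem_valueSet {v : ℚ} (hv : v ∈ valueSet φ) : -v ∈ valueSet φ := by
  obtain ⟨x, rfl⟩ := mem_valueSet.mp hv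
  exact mem_valueSet.mpr ⟨x.flipSign, toRat_flipSign x⟩

/-- Values are bounded by `maxRat` in absolute value. -/
theorem abs_le_maxRat_of_mem_valueSet {v : ℚ} (hv : v ∈ valueSet φ) : |v| ≤ φ.maxRat := by
  obtain ⟨x, rfl⟩ := mem_valueSet.mp hv
  exact abs_toRat_le_maxRat x

/-- Doubling stays in the format while in range: `0 ≤ a`, `2a ≤ maxRat` ⟹ `2a ∈ F`. -/
theorem two_mul_mem_valueSet {a : MiniFloat φ} (ha : 0 ≤ a.toRat) (h2 : 2 * a.toRat ≤ φ.maxRat) :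
    2 * a.toRat ∈ valueSet φ := by
  have hq := φ.quantum_pos
  have hA := toInt_eq_scaledMag_of_nonneg ha
  obtain ⟨-, k, j, hk, hkj⟩ := representable_iff.mp (representable_scaledMag a)
  have h2A : 2 * a.scaledMag ≤ φ.maxScaled := by
    have h : (2 : ℚ) * a.scaledMag * φ.quantum ≤ φ.maxScaled * φ.quantum := by
      have h2' := h2
      unfold MiniFloat.toRat Format.maxRat at h2'
      rw [hA] at h2'; push_cast at h2'; linarith
    exact_mod_cast le_of_mul_le_mul_right h hq
  have hle : k * 2 ^ (j + 1) ≤ φ.maxScaled := by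
    rw [pow_succ, ← mul_assoc, ← hkj]; omega
  obtain ⟨y, hy⟩ := exists_toRat_eq_intCast_mul ((k * 2 ^ (j + 1) : ℕ) : ℤ)
    (by rw [Int.natAbs_natCast]; exact representable_mul_pow hk hle)
  refine mem_valueSet.mpr ⟨y, ?_⟩
  rw [hy]; unfold MiniFloat.toRat; rw [hA, hkj]; push_cast; ring

/-- Halving: for `0 ≤ a` either `a/2 ∈ F`, or `a` lies in the bottom binades
(`a.scaledMag < 2^(m+1)`, where the grid is the quantum itself). -/
theorem half_mem_valueSet_or_lt (a : MiniFloat φ) (ha : 0 ≤ a.toRat) :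
    a.toRat / 2 ∈ valueSet φ ∨ a.scaledMag < 2 ^ (φ.manBits + 1) := by
  have hA := toInt_eq_scaledMag_of_nonneg ha
  obtain ⟨hmax, k, j, hk, hkj⟩ := representable_iff.mp (representable_scaledMag a)
  rcases j with _ | j
  · right; rw [hkj]; simpa using hk
  · left
    have hle : k * 2 ^ j ≤ φ.maxScaled := by
      refine le_trans ?_ hmax
      rw [hkj, pow_succ]
      exact Nat.mul_le_mul_left k (Nat.le_mul_of_pos_right _ two_pos)
    obtain ⟨y, hy⟩ := exists_toRat_eq_intCast_mul ((k * 2 ^ j : ℕ) : ℤ)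
      (by rw [Int.natAbs_natCast]; exact representable_mul_pow hk hle)
    refine mem_valueSet.mpr ⟨y, ?_⟩
    rw [hy]; unfold MiniFloat.toRat; rw [hA, hkj]; push_cast; ring

/-- In the bottom binades every signed magnitude up to `|a|` is a value: if
`a.scaledMag < 2^(m+1)` and `|N| ≤ a.scaledMag` then `N · quantum ∈ F`. -/
theorem intCast_mul_mem_valueSet {a : MiniFloat φ} (hA : a.scaledMag < 2 ^ (φ.manBits + 1))
    {N : ℤ} (hN : N.natAbs ≤ a.scaledMag) : (N : ℚ) * φ.quantum ∈ valueSet φ := by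
  obtain ⟨y, hy⟩ := exists_toRat_eq_intCast_mul N
    (representable_of_lt_pow (lt_of_le_of_lt hN hA) (hN.trans a.scaledMag_le_maxScaled))
  exact mem_valueSet.mpr ⟨y, hy⟩

/-! ### `s − a ∈ F` for every faithful rounding `s` of `a + b`, `|b| ≤ |a|` -/

/-- The case `0 ≤ a` of `sub_mem_of_faithful`. -/
theorem sub_mem_of_faithful_of_nonneg (a b : MiniFloat φ) (ha : 0 ≤ a.toRat)
    (hab : |b.toRat| ≤ |a.toRat|) {s : ℚ} (hs : Faithful (valueSet φ) (a.toRat + b.toRat) s) :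
    s - a.toRat ∈ valueSet φ := by
  set c := a.toRat + b.toRat with hc_def
  have hq := φ.quantum_pos
  have haF : a.toRat ∈ valueSet φ := toRat_mem_valueSet a
  have hba : |b.toRat| ≤ a.toRat := by rwa [abs_of_nonneg ha] at hab
  obtain ⟨s', hs'⟩ := mem_valueSet.mp hs.1
  have hsR : s ≤ φ.maxRat := hs' ▸ (le_abs_self _).trans (abs_toRat_le_maxRat s')
  -- if `c ∈ F` then `s = c` and `s - a = b`
  by_cases hcF : c ∈ valueSet φ
  · rw [hs.eq_of_mem hcF, show c - a.toRat = b.toRat by rw [hc_def]; ring]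
    exact toRat_mem_valueSet b
  -- otherwise Sterbenz on `(s, a)`: it suffices that `a/2 ≤ s ≤ 2a`
  suffices h : a.toRat / 2 ≤ s ∧ s ≤ 2 * a.toRat by
    obtain ⟨d, hd⟩ := sterbenz s' a (by rw [hs']; exact h.1) (by rw [hs']; exact h.2)
    exact mem_valueSet.mpr ⟨d, by rw [hd, hs']⟩
  rcases le_or_gt 0 b.toRat with hb | hb
  · -- `0 ≤ b`: `a ≤ c ≤ 2a`
    have hb' : b.toRat ≤ a.toRat := (le_abs_self _).trans hba
    rcases hs.2 with ⟨hsc, hmax⟩ | ⟨hcs, hmin⟩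
    · have := hmax _ haF (by linarith)
      constructor <;> linarith
    · refine ⟨by linarith, ?_⟩
      by_cases h2 : 2 * a.toRat ≤ φ.maxRat
      · exact hmin _ (two_mul_mem_valueSet ha h2) (by linarith)
      · linarith
  · -- `b < 0`: `0 ≤ c < a`; as `c ∉ F`, near-cancellation `c < -b` is excluded (Sterbenz)
    have hb' : -b.toRat ≤ a.toRat := (neg_le_abs _).trans hba
    have hcb : -b.toRat ≤ c := by
      by_contra hlt
      push Not at hlt
      apply hcF
      obtain ⟨y, hy⟩ := exists_toRat_eq_add_of_cancel a b hab
        (by rw [abs_of_neg hb, abs_of_nonneg (by linarith)]; exact hlt)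
      exact mem_valueSet.mpr ⟨y, hy⟩
    rcases hs.2 with ⟨hsc, hmax⟩ | ⟨hcs, hmin⟩
    · -- `s` is the largest value `≤ c`: a value in `[a/2, c]` is needed
      refine ⟨?_, by linarith⟩
      rcases half_mem_valueSet_or_lt a ha with hhalf | hsmall
      · exact hmax _ hhalf (by linarith)
      · -- bottom binades: then `c` itself is a value, contradicting `c ∉ F`
        exfalso
        apply hcF
        have hA := toInt_eq_scaledMag_of_nonneg ha
        have hcN : c = ((a.toInt + b.toInt : ℤ) : ℚ) * φ.quantum := by
          rw [hc_def]; unfold MiniFloat.toRat; push_cast; ring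
        rw [hcN]
        apply intCast_mul_mem_valueSet hsmall
        have h0 : ((0 : ℤ) : ℚ) ≤ ((a.toInt + b.toInt : ℤ) : ℚ) := by
          have h : 0 * φ.quantum ≤ ((a.toInt + b.toInt : ℤ) : ℚ) * φ.quantum := by
            rw [zero_mul, ← hcN]; linarith
          rw [Int.cast_zero]; exact le_of_mul_le_mul_right h hq
        have h1 : ((a.toInt + b.toInt : ℤ) : ℚ) ≤ ((a.scaledMag : ℤ) : ℚ) := by
          have h : ((a.toInt + b.toInt : ℤ) : ℚ) * φ.quantum ≤ (a.scaledMag : ℚ) * φ.quantum := by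
            rw [← hcN]
            have : c ≤ a.toRat := by linarith
            unfold MiniFloat.toRat at this; rw [hA] at this; exact_mod_cast this
          exact_mod_cast le_of_mul_le_mul_right h hq
        have h0' : (0 : ℤ) ≤ a.toInt + b.toInt := by exact_mod_cast h0
        have h1' : a.toInt + b.toInt ≤ (a.scaledMag : ℤ) := by exact_mod_cast h1
        omega
    · -- `s` is the smallest value `≥ c`: `c ≤ s ≤ a`
      have := hmin _ haF (by linarith)
      constructor <;> linarith

/-- **`s − a ∈ F` (every format, saturation included).** For data `a, b` with `|b| ≤ |a|` and ANY
faithful saturating rounding `s` of `a + b` into the format, `s − a` is a value of the format.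
[cite: BoldoGraillatMuller2017, Lemma 2.5 (radix 2, unbounded exponents); finite saturating
model new] -/
theorem sub_mem_of_faithful (a b : MiniFloat φ) (hab : |b.toRat| ≤ |a.toRat|) {s : ℚ}
    (hs : Faithful (valueSet φ) (a.toRat + b.toRat) s) : s - a.toRat ∈ valueSet φ := by
  rcases le_or_gt 0 a.toRat with ha | ha
  · exact sub_mem_of_faithful_of_nonneg a b ha hab hs
  · have hs' : Faithful (valueSet φ) (a.flipSign.toRat + b.flipSign.toRat) (-s) := by
      rw [toRat_flipSign, toRat_flipSign, ← neg_add]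
      exact hs.neg fun y hy => neg_mem_valueSet hy
    have h := sub_mem_of_faithful_of_nonneg a.flipSign b.flipSign
      (by rw [toRat_flipSign]; linarith) (by simpa only [toRat_flipSign, abs_neg] using hab) hs'
    have h' := neg_mem_valueSet h
    rw [toRat_flipSign] at h'
    convert h' using 1; ring

/-- Under SR: both candidates `dn F (a+b)`, `up F (a+b)` give `s − a ∈ F`, so the second Fast2Sum
operation `z = SR(s − a)` returns `s − a` surely (`step_of_mem`). -/
theorem dn_sub_mem (a b : MiniFloat φ) (hab : |b.toRat| ≤ |a.toRat|) :
    dn (valueSet φ) (a.toRat + b.toRat) - a.toRat ∈ valueSet φ ∧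
    up (valueSet φ) (a.toRat + b.toRat) - a.toRat ∈ valueSet φ :=
  ⟨sub_mem_of_faithful a b hab (dn_faithful (valueSet_nonempty φ) _),
    sub_mem_of_faithful a b hab (up_faithful (valueSet_nonempty φ) _)⟩

/-! ### The committed error of a faithful rounding lies in the hull -/

/-- For ANY faithful saturating rounding `s` of `a + b` (data `a, b`, no order hypothesis),
`|a + b − s| ≤ maxRat`. (Not `≤ |b|` in general: the far candidate's error can exceed `|b|`.) -/
theorem abs_err_le_maxRat_of_faithful (a b : MiniFloat φ) {s : ℚ}
    (hs : Faithful (valueSet φ) (a.toRat + b.toRat) s) : |a.toRat + b.toRat - s| ≤ φ.maxRat := by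
  set c := a.toRat + b.toRat with hc_def
  have haR := abs_toRat_le_maxRat a
  have hbR := abs_toRat_le_maxRat b
  have hsR := abs_le_maxRat_of_mem_valueSet hs.1
  have h0F : (0 : ℚ) ∈ valueSet φ := by simpa using toRat_mem_valueSet (MiniFloat.zero φ)
  have hRF := maxRat_mem_valueSet φ
  have hnRF := neg_maxRat_mem_valueSet φ
  rw [abs_le] at haR hbR hsR ⊢
  rcases hs.2 with ⟨hsc, hmax⟩ | ⟨hcs, hmin⟩
  · refine ⟨by linarith, ?_⟩
    rcases le_or_gt 0 c with hc0 | hc0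
    · rcases le_or_gt c φ.maxRat with hcR | hcR
      · have := hmax 0 h0F hc0; linarith
      · have := hmax _ hRF hcR.le; linarith
    · linarith
  · refine ⟨?_, by linarith⟩
    rcases le_or_gt c 0 with hc0 | hc0
    · rcases le_or_gt (-φ.maxRat) c with hcR | hcR
      · have := hmin 0 h0F hc0; linarith
      · have := hmin _ hnRF hcR.le; linarith
    · linarith

/-- The committed error `a + b − s` of a faithful rounding lies in the representable hull, so a
further saturating SR step rounds it without saturation bias. -/
theorem inHull_err_of_faithful (a b : MiniFloat φ) {s : ℚ}
    (hs : Faithful (valueSet φ) (a.toRat + b.toRat) s) :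
    InHull (valueSet φ) (a.toRat + b.toRat - s) :=
  (valueSet_inHull_iff φ _).mpr (abs_err_le_maxRat_of_faithful a b hs)

/-- Kernel instance (E3M2, via the literal table of file III′): for `a = 24`, `b = 1/16` the upper
candidate is `28` with error `−63/16`, larger than `|b|` in magnitude but inside the hull, and
`28 − 24 = 4 ∈ F`. -/
theorem err_exceeds_b_E3M2 :
    up Formats.e3m2 ((24 : ℚ) + 1 / 16) = 28 ∧ (24 : ℚ) + 1 / 16 - 28 = -63 / 16 ∧
    (63 : ℚ) / 16 ∉ Formats.e3m2 ∧ (28 : ℚ) - 24 ∈ Formats.e3m2 := by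
  refine ⟨by decide +kernel, by norm_num, by decide +kernel, by decide +kernel⟩

end Formats

end Summit.Ventures.CertifiedArithmetic.LowPrec.SR
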